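import Literature.MathematicalPhysics.KineticTheory.HardSphereEulerProofs
import Literature.Analysis.FluidPDE.HardSphereFlowJointMeasurable
import Summits.AtomisticToContinuum.HydrodynamicLimit.Theorems.OneFlightGossipEngineCollisionActivityTailsNearFieldKineticTailsPathwise
import Summits.AtomisticToContinuum.HydrodynamicLimit.Theses.JParityClosure
import Summits.AtomisticToContinuum.HydrodynamicLimit.Theses.OneFlightGossipEngine
import HarnessLib

/-!
# `CollisionActivityTails` (stmt-AtomisticToContinuum-13734), line `SketchK1`: the near-field kinetic tail
statement reduces to quadratic-velocity UI plus an in-probability tagged-sphere window LLN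

Helper file (`--supports stmt-AtomisticToContinuum-13734`) for the crux
`Summit.AtomisticToContinuum.HydrodynamicLimit.Theses.OneFlightGossipEngine.CollisionActivityTails`
(shared with `…Theses.TwoClocks.CollisionActivityTails`), skeleton line `SketchK1`, registered stub
`stub_nearFieldReduction : KineticEnergyTails → NearFieldFractionLLN → NearFieldKineticTails`. File 3 of 3
(after `…NearFieldKineticTailsStatics`, `…NearFieldKineticTailsPathwise`).

* `NearFieldKineticTails` — the line's stub 5, verbatim from the registered skeleton: in the crux's frame and
  quantifier shape, the `L¹` tail of the window-averaged near-field relative kinetic energy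
  `F²_i = w⁻¹ ∫_s^{s+w} Σ_{j ≠ i, dist ≤ 2ε} |v_j − v_i|² dt` above `V ≥ V₀` vanishes as `τ → ∞` after `N → ∞`,
  uniformly in `s ≤ t < T`, under the TRUE law `λ₀ ∘ Φ`;
* `NearFieldFractionLLN` — the minimal missing DYNAMICAL fact (stub 5b, open): same frame and shape for the
  expected FRACTION `(N+1)⁻¹ Σ_i 𝟙{V < F²_i}` (a law of large numbers in probability for the co-moving `2ε`-ball
  kinetic occupation of a uniformly chosen tagged sphere; bounded integrand, no `L¹` weight);
* `nearFieldKineticTails_of_kineticEnergyTails_of_fractionLLN` (= `stub_nearFieldReduction`):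
  `JParityClosure.KineticEnergyTails → NearFieldFractionLLN → NearFieldKineticTails`, where `KineticEnergyTails`
  (item stmt-AtomisticToContinuum-13087, stub 5a) is uniform integrability of `(N+1)⁻¹ Σ_i |v_i(s)|² 𝟙{M < |v_i(s)|}`
  along the true flow before the shock;
* `nearFieldFractionLLN_of_nearFieldKineticTails` — necessity of the fraction LLN (Markov at level `V`);
* `nearFieldKineticTails_of_energyCurrentTails_of_fractionLLN` — the same reduction from the route's CUBIC binder
  `OneFlightGossipEngine.EnergyCurrentTails` (stmt-9235), so that inside the route stub 5 is equivalent to the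
  fraction LLN.

Mechanism (constants absolute). Pathwise on the good set (`…Pathwise.avgTail_nearFieldKinetic_le`):
`(N+1)⁻¹ Σ_i 𝟙{V < F²_i} F²_i ≤ 2000 · w⁻¹ ∫_s^{s+w} kinTailAvg M (Φ_t z) dt + 1000 M² · (N+1)⁻¹ Σ_i 𝟙{V < F²_i}`
(truncation at `M' = 1000 M²`, hard-core packing, "a fast relative velocity needs a fast partner", double
counting). Then **Tonelli along the window** (`lintegral_ofReal_intervalIntegral_flow_le`: joint measurability
of the flow on its good set, `HardSphereFlow.measurable_flow_prod_torus`, and `lintegral_lintegral_swap`) bounds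
the expectation of the window average by `sup_{t' ∈ (s, s+w]} 𝔼[kinTailAvg M (Φ_{t'} ·)] ≤ ε/4000`, which
`KineticEnergyTails` supplies on the extended horizon `t' = (t+T)/2` since `w_N → 0` (`exists_window_le`); the
fraction term is `≤ M' δ` by `NearFieldFractionLLN` at accuracy `δ = ε / (2(M'+1))`. Bookkeeping:
`σ₀ = min σ₁ σ₂ (1/2)` (so the local Gibbs law is a probability measure), `N₀ = max N₁ N₂ N₃`.

References: H. Spohn, *Large Scale Dynamics of Interacting Particles* (1991), Part I §2.3 (local Gibbs states);
C. Cercignani, R. Illner, M. Pulvirenti, *The Mathematical Theory of Dilute Gases* (1994), §4.2, App. 4.A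
(the hard-sphere flow and time averages along it). The reduction itself is elementary and recorded here.
-/

noncomputable section

open MeasureTheory Set Filter Topology
open scoped ENNReal

namespace Summit.AtomisticToContinuum.HydrodynamicLimit.Theorems.CollisionActivityTailsNearFieldKineticTails

open Literature.MathematicalPhysics.KineticTheory Literature.Analysis.FluidPDE
open Summit.AtomisticToContinuum.HydrodynamicLimit.Theses.JParityClosure (KineticEnergyTails)

/-! ## §1 Statements -/

/-- **NEAR-FIELD KINETIC TAILS** (stub 5 of line `SketchK1`; OPEN — card `one-flight-thinning-tails`), verbatim
from the registered skeleton: in the crux's own frame and shape, the `L¹` tail of the window-averaged near-field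
relative kinetic energy `F²_i` above `V ≥ V₀` vanishes as `τ → ∞` after `N → ∞`, uniformly in `s ≤ t < T`;
with the measurability of the tail sum (landed for all data, `aemeasurable_sum_tailFn_nearFieldKinetic`). -/
def NearFieldKineticTails : Prop :=
  ∀ (a₀ θ₀ : T3 → ℝ) (u₀ : T3 → V3), Continuous a₀ → Continuous θ₀ → Continuous u₀ →
    (∀ x, 0 < a₀ x) → (∀ x, 0 < θ₀ x) → ∃ σ₀ : ℝ, 0 < σ₀ ∧ ∀ σ : ℝ, 0 < σ → σ < σ₀ →
    ∀ (T : ℝ) (ρ θ : ℝ → T3 → ℝ) (u : ℝ → T3 → V3), IsHardSphereEulerSolution σ T ρ u θ →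
    ∀ Φ : (N : ℕ) → Flow σ N,
    TendstoHydroFieldsAt (fun N => localGibbsLaw σ a₀ u₀ θ₀ N (Φ N)) Φ ρ u θ 0 →
    ∀ t ∈ Set.Ico 0 T, ∃ V₀ : ℝ, 0 < V₀ ∧ ∀ V : ℝ, V₀ ≤ V → ∀ ε : ℝ, 0 < ε →
    ∃ τ₀ : ℝ, 0 < τ₀ ∧ ∀ τ : ℝ, τ₀ ≤ τ → ∃ N₀ : ℕ, ∀ N : ℕ, N₀ ≤ N → ∀ s ∈ Set.Icc 0 t,
      AEMeasurable (fun z => ∑ i : Fin (N + 1), tailFn V (nearFieldKinetic (Φ N) τ s i z))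
          (localGibbsLaw σ a₀ u₀ θ₀ N (Φ N)) ∧
      ∫⁻ z, ENNReal.ofReal (((N : ℝ) + 1)⁻¹ * ∑ i : Fin (N + 1), tailFn V (nearFieldKinetic (Φ N) τ s i z))
        ∂(localGibbsLaw σ a₀ u₀ θ₀ N (Φ N)) ≤ ENNReal.ofReal ε


/-- **NEAR-FIELD FRACTION LLN** — the minimal missing dynamical fact behind stub 5. In the crux's frame and
quantifier shape: the expected fraction of spheres whose window-averaged near-field relative kinetic energy
`F²_i = w⁻¹ ∫_s^{s+w} Σ_{j ≠ i, |x_j − x_i| ≤ 2ε} |v_j − v_i|² dt` exceeds `V ≥ V₀` vanishes as `τ → ∞` after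
`N → ∞`, uniformly in `s ≤ t < T`, under the TRUE law `λ₀ ∘ Φ`: a law of large numbers in probability, in the
window length, for the co-moving `2ε`-ball kinetic occupation of a uniformly chosen tagged sphere (its window
averages have no mass above the deterministic level `V₀` in the iterated limit). Mechanisms it encodes: fast
tagged spheres thermalise in `o(w)`; the stream of fast visitors of a tagged sphere is not anomalously intense for
a positive fraction of spheres (no persistent hot droplets / hot spots of positive mass). Since `𝟙{V < ·}` is
antitone in `V`, the statement is equivalent to its instance `V = V₀` (`∃ V₀ ∀ δ ∃ τ₀ ∀ τ ≥ τ₀ ∃ N₀ ∀ N ≥ N₀ ∀ s`);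
the crux's shape is kept for uniformity with the skeleton. -/
def NearFieldFractionLLN : Prop :=
  ∀ (a₀ θ₀ : T3 → ℝ) (u₀ : T3 → V3), Continuous a₀ → Continuous θ₀ → Continuous u₀ →
    (∀ x, 0 < a₀ x) → (∀ x, 0 < θ₀ x) → ∃ σ₀ : ℝ, 0 < σ₀ ∧ ∀ σ : ℝ, 0 < σ → σ < σ₀ →
    ∀ (T : ℝ) (ρ θ : ℝ → T3 → ℝ) (u : ℝ → T3 → V3), IsHardSphereEulerSolution σ T ρ u θ →
    ∀ Φ : (N : ℕ) → Flow σ N,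
    TendstoHydroFieldsAt (fun N => localGibbsLaw σ a₀ u₀ θ₀ N (Φ N)) Φ ρ u θ 0 →
    ∀ t ∈ Set.Ico 0 T, ∃ V₀ : ℝ, 0 < V₀ ∧ ∀ V : ℝ, V₀ ≤ V → ∀ δ : ℝ, 0 < δ →
    ∃ τ₀ : ℝ, 0 < τ₀ ∧ ∀ τ : ℝ, τ₀ ≤ τ → ∃ N₀ : ℕ, ∀ N : ℕ, N₀ ≤ N → ∀ s ∈ Set.Icc 0 t,
      ∫⁻ z, ENNReal.ofReal (((N : ℝ) + 1)⁻¹ * ∑ i : Fin (N + 1), fracFn V (nearFieldKinetic (Φ N) τ s i z))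
        ∂(localGibbsLaw σ a₀ u₀ θ₀ N (Φ N)) ≤ ENNReal.ofReal δ

/-! ## §2 Expectations: Tonelli along the window for laws carried by the good set -/

section Expectation

variable {σ : ℝ} {N : ℕ}

/-- Under the local Gibbs law almost every datum is good. -/
theorem ae_mem_good_localGibbsLaw' (σ : ℝ) (a₀ θ₀ : T3 → ℝ) (u₀ : T3 → V3) (N : ℕ) (Φ : Flow σ N) :
    ∀ᵐ z ∂(localGibbsLaw σ a₀ u₀ θ₀ N Φ), z ∈ Φ.good := by
  have h := compl_mem_ae_iff.2 (localGibbsLaw_compl_good σ a₀ θ₀ u₀ N Φ)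
  rwa [compl_compl] at h

/-- **Tonelli along the window.** For a law `μ` carried by the good set, a nonnegative measurable observable `f`
that is time-integrable along good orbits, and a window `(a, b]`: if `∫⁻ ofReal (f ∘ Φ_t) dμ ≤ C` for every
`t ∈ (a, b]`, then `∫⁻ ofReal (∫_a^b f(Φ_t z) dt) dμ ≤ C · (b − a)` (joint measurability of the flow on its good
set, `HardSphereFlow.measurable_flow_prod_torus`, and `lintegral_lintegral_swap`). -/
theorem lintegral_ofReal_intervalIntegral_flow_le (Φ : Flow σ N) {μ : Measure (Cfg N)} [SFinite μ]
    (hμ : μ Φ.goodᶜ = 0) {f : Cfg N → ℝ} (hf : Measurable f) (hf0 : ∀ y, 0 ≤ f y)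
    (hint : ∀ z ∈ Φ.good, ∀ a b : ℝ, a ≤ b → IntervalIntegrable (fun t => f (Φ.flow t z)) volume a b)
    {a b : ℝ} (hab : a ≤ b) {C : ℝ≥0∞}
    (hC : ∀ t ∈ Set.Ioc a b, ∫⁻ z, ENNReal.ofReal (f (Φ.flow t z)) ∂μ ≤ C) :
    ∫⁻ z, ENNReal.ofReal (∫ t in a..b, f (Φ.flow t z)) ∂μ ≤ C * ENNReal.ofReal (b - a) := by
  classical
  -- a jointly measurable version of `(z, t) ↦ ofReal (f (Φ_t z))`
  set S : Set (Cfg N × ℝ) := Prod.fst ⁻¹' Φ.good with hS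
  have hSm : MeasurableSet S := measurable_fst Φ.measurableSet_good
  set g : S → ℝ≥0∞ := fun q =>
    ENNReal.ofReal (f (Φ.flow q.1.2 ((⟨q.1.1, q.2⟩ : Φ.good) : Cfg N))) with hg_def
  have hg : Measurable g := by
    have h1 : Measurable fun q : S => ((⟨q.1.1, q.2⟩ : Φ.good), q.1.2) :=
      (measurable_subtype_coe.fst.subtype_mk).prodMk measurable_subtype_coe.snd
    exact ENNReal.measurable_ofReal.comp (hf.comp (Φ.measurable_flow_prod_torus.comp h1))
  set F : Cfg N × ℝ → ℝ≥0∞ := fun p => if hp : p ∈ S then g ⟨p, hp⟩ else 0 with hF_def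
  have hF : Measurable F := Measurable.dite hg measurable_const hSm
  have hFeq : ∀ p : Cfg N × ℝ, p.1 ∈ Φ.good → F p = ENNReal.ofReal (f (Φ.flow p.2 p.1)) := by
    intro p hp
    have hpS : p ∈ S := hp
    simp only [hF_def, dif_pos hpS, hg_def]
  have hae : ∀ᵐ z ∂μ, z ∈ Φ.good := by
    have h := compl_mem_ae_iff.2 hμ
    rwa [compl_compl] at h
  -- on the good set the real window integral is a `lintegral` of `F`
  have h1 : ∀ z ∈ Φ.good,
      ENNReal.ofReal (∫ t in a..b, f (Φ.flow t z)) = ∫⁻ t in Set.Ioc a b, F (z, t) := by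
    intro z hz
    rw [intervalIntegral.integral_of_le hab,
      ofReal_integral_eq_lintegral_ofReal (hint z hz a b hab).1 (ae_of_all _ fun t => hf0 _)]
    exact setLIntegral_congr_fun measurableSet_Ioc fun t _ => (hFeq (z, t) hz).symm
  -- Tonelli
  have h2 : ∫⁻ z, (∫⁻ t in Set.Ioc a b, F (z, t)) ∂μ = ∫⁻ t in Set.Ioc a b, (∫⁻ z, F (z, t) ∂μ) :=
    lintegral_lintegral_swap hF.aemeasurable
  -- at fixed times the inner integrals are the expectations
  have h3 : ∀ t ∈ Set.Ioc a b, (∫⁻ z, F (z, t) ∂μ) ≤ C := by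
    intro t ht
    calc ∫⁻ z, F (z, t) ∂μ = ∫⁻ z, ENNReal.ofReal (f (Φ.flow t z)) ∂μ :=
          lintegral_congr_ae (by filter_upwards [hae] with z hz using hFeq (z, t) hz)
      _ ≤ C := hC t ht
  calc ∫⁻ z, ENNReal.ofReal (∫ t in a..b, f (Φ.flow t z)) ∂μ
      = ∫⁻ z, (∫⁻ t in Set.Ioc a b, F (z, t)) ∂μ :=
        lintegral_congr_ae (by filter_upwards [hae] with z hz using h1 z hz)
    _ = ∫⁻ t in Set.Ioc a b, (∫⁻ z, F (z, t) ∂μ) := h2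
    _ ≤ ∫⁻ _ in Set.Ioc a b, C := setLIntegral_mono' measurableSet_Ioc h3
    _ = C * ENNReal.ofReal (b - a) := by rw [setLIntegral_const, Real.volume_Ioc]

end Expectation

/-! ## §3 The reduction: `KineticEnergyTails ∧ NearFieldFractionLLN ⟹ NearFieldKineticTails` -/

/-- The integrand of `KineticEnergyTails` is `kinTailAvg` (by `rfl`). -/
theorem kinTailAvg_eq {N : ℕ} (M : ℝ) (y : Cfg N) :
    kinTailAvg M y = ((N : ℝ) + 1)⁻¹ * ∑ i : Fin (N + 1),
      Set.indicator {v : V3 | M < ‖v‖} (fun v => ‖v‖ ^ 2) ((y i).2) := rfl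

/-- **REDUCTION OF STUB 5.** Uniform integrability of the kinetic energy along the true flow
(`JParityClosure.KineticEnergyTails`, item stmt-AtomisticToContinuum-13087, open) and the in-probability
tagged-sphere window LLN `NearFieldFractionLLN` imply the registered statement `NearFieldKineticTails`.
Bookkeeping: `σ₀ = min σ₁ σ₂ (1/2)` (the law is then a probability measure); `V₀` from the LLN; given `V ≥ V₀` and
`ε`, the quadratic UI on the horizon `t' = (t+T)/2` at accuracy `ε/4000` gives the cut-off `M`; the LLN at level
`V` and accuracy `ε / (2(M'+1))`, `M' = 1000 M²`, gives `τ₀` and `N₂`; `N₀ = max N₁ N₂ N₃` with `w_N ≤ t' − t` for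
`N ≥ N₃`. -/
theorem nearFieldKineticTails_of_kineticEnergyTails_of_fractionLLN
    (hKE : KineticEnergyTails) (hFR : NearFieldFractionLLN) : NearFieldKineticTails := by
  intro a₀ θ₀ u₀ ha hθ hu ha0 hθ0
  obtain ⟨σ₁, hσ₁, hKE⟩ := hKE a₀ θ₀ u₀ ha hθ hu ha0 hθ0
  obtain ⟨σ₂, hσ₂, hFR⟩ := hFR a₀ θ₀ u₀ ha hθ hu ha0 hθ0
  refine ⟨min (min σ₁ σ₂) (1 / 2), lt_min (lt_min hσ₁ hσ₂) (by norm_num), ?_⟩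
  intro σ hσ hσlt T ρ θ u hsol Φ hLLN t ht
  have hσ₁' : σ < σ₁ := hσlt.trans_le ((min_le_left _ _).trans (min_le_left _ _))
  have hσ₂' : σ < σ₂ := hσlt.trans_le ((min_le_left _ _).trans (min_le_right _ _))
  have hσ2 : σ ≤ 1 / 2 := (hσlt.trans_le (min_le_right _ _)).le
  have hKE := hKE σ hσ hσ₁' T ρ θ u hsol Φ hLLN
  obtain ⟨V₀, hV₀, hFR⟩ := hFR σ hσ hσ₂' T ρ θ u hsol Φ hLLN t ht
  refine ⟨V₀, hV₀, ?_⟩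
  intro V hV ε hε
  obtain ⟨ht0, htT⟩ := ht
  -- the extended horizon `t' = (t + T)/2`
  set t' : ℝ := (t + T) / 2 with ht'
  have htt' : t < t' := by rw [ht']; linarith
  have ht'T : t' < T := by rw [ht']; linarith
  obtain ⟨M, N₁, hM⟩ := hKE t' ⟨by linarith, ht'T⟩ (ε / 4000) (by positivity)
  set M' : ℝ := 1000 * M ^ 2 with hM'
  have hM'0 : 0 ≤ M' := by positivity
  obtain ⟨τ₀, hτ₀, hFRτ⟩ := hFR V hV (ε / (2 * (M' + 1))) (by positivity)
  refine ⟨τ₀, hτ₀, ?_⟩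
  intro τ hτ
  have hτ0 : 0 < τ := hτ₀.trans_le hτ
  obtain ⟨N₂, hFRN⟩ := hFRτ τ hτ
  obtain ⟨N₃, hN₃w⟩ := exists_window_le hτ0 (by linarith : 0 < t' - t)
  refine ⟨max N₁ (max N₂ N₃), ?_⟩
  intro N hN s hs
  have hN₁ : N₁ ≤ N := (le_max_left _ _).trans hN
  have hN₂ : N₂ ≤ N := ((le_max_left _ _).trans (le_max_right _ _)).trans hN
  have hN₃ : N₃ ≤ N := ((le_max_right _ _).trans (le_max_right _ _)).trans hN
  obtain ⟨hs0, hst⟩ := hs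
  refine ⟨aemeasurable_sum_tailFn_nearFieldKinetic σ a₀ θ₀ u₀ N (Φ N) τ s V, ?_⟩
  -- notation and basic facts
  set P := localGibbsLaw σ a₀ u₀ θ₀ N (Φ N) with hP
  haveI : IsProbabilityMeasure P := isProbabilityMeasure_localGibbsLaw ha hθ hu ha0 hθ0 hσ2 N (Φ N)
  set w := window τ N with hw
  have hw0 : 0 < w := window_pos' hτ0 N
  have hwle : w ≤ t' - t := hN₃w N hN₃
  have hsw : s ≤ s + w := le_add_of_nonneg_right hw0.le
  have hgood : ∀ᵐ z ∂P, z ∈ (Φ N).good := ae_mem_good_localGibbsLaw' σ a₀ θ₀ u₀ N (Φ N)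
  have hPc : P (Φ N).goodᶜ = 0 := localGibbsLaw_compl_good σ a₀ θ₀ u₀ N (Φ N)
  -- the two terms of the pathwise bound
  set A : Cfg N → ℝ := fun z => w⁻¹ * ∫ r in s..(s + w), kinTailAvg M ((Φ N).flow r z) with hA
  set B : Cfg N → ℝ := fun z => ((N : ℝ) + 1)⁻¹ * ∑ i, fracFn V (nearFieldKinetic (Φ N) τ s i z) with hB
  have hAm : AEMeasurable A P :=
    ((Φ N).aemeasurable_intervalIntegral_comp_flow_torus (measurable_kinTailAvg M) s (s + w) hPc).const_mul _
  have hpt : ∀ᵐ z ∂P, ENNReal.ofReal (((N : ℝ) + 1)⁻¹ * ∑ i, tailFn V (nearFieldKinetic (Φ N) τ s i z)) ≤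
      ENNReal.ofReal (2000 * A z) + ENNReal.ofReal (M' * B z) := by
    filter_upwards [hgood] with z hz
    exact (ENNReal.ofReal_le_ofReal (avgTail_nearFieldKinetic_le hσ (Φ N) hτ0 s hz M V)).trans
      ENNReal.ofReal_add_le
  -- expectation of the first term: Tonelli and `KineticEnergyTails` on `(s, s + w] ⊆ [0, t']`
  have hIA : ∫⁻ z, ENNReal.ofReal (2000 * A z) ∂P ≤ ENNReal.ofReal (ε / 2) := by
    have hC : ∀ r ∈ Set.Ioc s (s + w),
        ∫⁻ z, ENNReal.ofReal (kinTailAvg M ((Φ N).flow r z)) ∂P ≤ ENNReal.ofReal (ε / 4000) := by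
      intro r hr
      have hr' : r ∈ Set.Icc 0 t' := ⟨by linarith [hr.1], by linarith [hr.2]⟩
      exact hM N hN₁ r hr'
    have hT := lintegral_ofReal_intervalIntegral_flow_le (Φ N) hPc (measurable_kinTailAvg M)
      (kinTailAvg_nonneg M) (fun z hz a b hab => intervalIntegrable_kinTailAvg (Φ N) hz M hab) hsw hC
    calc ∫⁻ z, ENNReal.ofReal (2000 * A z) ∂P
        = ∫⁻ z, ENNReal.ofReal (2000 * w⁻¹) *
            ENNReal.ofReal (∫ r in s..(s + w), kinTailAvg M ((Φ N).flow r z)) ∂P := by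
          refine lintegral_congr fun z => ?_
          rw [← ENNReal.ofReal_mul (by positivity), mul_assoc]
      _ = ENNReal.ofReal (2000 * w⁻¹) *
            ∫⁻ z, ENNReal.ofReal (∫ r in s..(s + w), kinTailAvg M ((Φ N).flow r z)) ∂P :=
          lintegral_const_mul' _ _ ENNReal.ofReal_ne_top
      _ ≤ ENNReal.ofReal (2000 * w⁻¹) * (ENNReal.ofReal (ε / 4000) * ENNReal.ofReal (s + w - s)) :=
          mul_le_mul' le_rfl hT
      _ = ENNReal.ofReal (ε / 2) := by
          rw [add_sub_cancel_left, ← ENNReal.ofReal_mul (by positivity), ← ENNReal.ofReal_mul (by positivity)]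
          congr 1
          field_simp
          ring
  -- expectation of the second term: the fraction LLN
  have hIB : ∫⁻ z, ENNReal.ofReal (M' * B z) ∂P ≤ ENNReal.ofReal (M' * (ε / (2 * (M' + 1)))) := by
    calc ∫⁻ z, ENNReal.ofReal (M' * B z) ∂P = ∫⁻ z, ENNReal.ofReal M' * ENNReal.ofReal (B z) ∂P :=
          lintegral_congr fun z => ENNReal.ofReal_mul hM'0
      _ = ENNReal.ofReal M' * ∫⁻ z, ENNReal.ofReal (B z) ∂P := lintegral_const_mul' _ _ ENNReal.ofReal_ne_top
      _ ≤ ENNReal.ofReal M' * ENNReal.ofReal (ε / (2 * (M' + 1))) :=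
          mul_le_mul' le_rfl (hFRN N hN₂ s ⟨hs0, hst⟩)
      _ = ENNReal.ofReal (M' * (ε / (2 * (M' + 1)))) := (ENNReal.ofReal_mul hM'0).symm
  -- conclusion
  have hsum : ε / 2 + M' * (ε / (2 * (M' + 1))) ≤ ε := by
    have hM'1 : (0 : ℝ) < 2 * (M' + 1) := by positivity
    have key : M' * (ε / (2 * (M' + 1))) ≤ ε / 2 := by
      rw [mul_div_assoc', div_le_div_iff₀ hM'1 (by norm_num : (0 : ℝ) < 2)]
      nlinarith [hε.le, hM'0]
    linarith
  calc ∫⁻ z, ENNReal.ofReal (((N : ℝ) + 1)⁻¹ * ∑ i, tailFn V (nearFieldKinetic (Φ N) τ s i z)) ∂P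
      ≤ ∫⁻ z, (ENNReal.ofReal (2000 * A z) + ENNReal.ofReal (M' * B z)) ∂P := lintegral_mono_ae hpt
    _ = ∫⁻ z, ENNReal.ofReal (2000 * A z) ∂P + ∫⁻ z, ENNReal.ofReal (M' * B z) ∂P :=
        lintegral_add_left' (hAm.const_mul _).ennreal_ofReal _
    _ ≤ ENNReal.ofReal (ε / 2) + ENNReal.ofReal (M' * (ε / (2 * (M' + 1)))) := add_le_add hIA hIB
    _ = ENNReal.ofReal (ε / 2 + M' * (ε / (2 * (M' + 1)))) :=
        (ENNReal.ofReal_add (by positivity) (by positivity)).symm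
    _ ≤ ENNReal.ofReal ε := ENNReal.ofReal_le_ofReal hsum

/-! ## §4 The converse, and the route-internal equivalence

`NearFieldFractionLLN` is NECESSARY for the stub (`𝟙{V<y} ≤ V⁻¹ 𝟙{V<y} y`), and the quadratic UI is implied by
the cubic item `EnergyCurrentTails` (stmt-AtomisticToContinuum-9235), which is ALREADY a binder of the deciding
theorem `closes` of both routes consuming the crux (TwoClocks, OneFlightGossipEngine). Hence, inside the route,
stub 5 is EQUIVALENT to the in-probability tagged-sphere window LLN `NearFieldFractionLLN`. -/

/-- `𝟙{V < y} ≤ V⁻¹ · 𝟙{V < y} y` for `V > 0`. -/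
theorem fracFn_le_inv_mul_tailFn {V : ℝ} (hV : 0 < V) (y : ℝ) : fracFn V y ≤ V⁻¹ * tailFn V y := by
  by_cases h : V < y
  · rw [fracFn_of_lt h, tailFn_of_lt h, le_inv_mul_iff₀ hV]
    linarith
  · rw [fracFn_of_le (not_lt.1 h), tailFn_of_le (not_lt.1 h), mul_zero]

/-- **The fraction LLN is necessary**: `NearFieldKineticTails → NearFieldFractionLLN` (Markov at level `V`:
ask the tail statement for accuracy `δ V`). -/
theorem nearFieldFractionLLN_of_nearFieldKineticTails (h : NearFieldKineticTails) : NearFieldFractionLLN := by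
  intro a₀ θ₀ u₀ ha hθ hu ha0 hθ0
  obtain ⟨σ₀, hσ₀, h⟩ := h a₀ θ₀ u₀ ha hθ hu ha0 hθ0
  refine ⟨σ₀, hσ₀, fun σ hσ hσlt T ρ θ u hsol Φ hLLN t ht => ?_⟩
  obtain ⟨V₀, hV₀, h⟩ := h σ hσ hσlt T ρ θ u hsol Φ hLLN t ht
  refine ⟨V₀, hV₀, fun V hV δ hδ => ?_⟩
  have hVpos : 0 < V := hV₀.trans_le hV
  obtain ⟨τ₀, hτ₀, h⟩ := h V hV (δ * V) (by positivity)
  refine ⟨τ₀, hτ₀, fun τ hτ => ?_⟩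
  obtain ⟨N₀, h⟩ := h τ hτ
  refine ⟨N₀, fun N hN s hs => ?_⟩
  obtain ⟨-, hint⟩ := h N hN s hs
  have hN0 : (0 : ℝ) ≤ ((N : ℝ) + 1)⁻¹ := inv_nonneg.2 (by positivity)
  calc ∫⁻ z, ENNReal.ofReal (((N : ℝ) + 1)⁻¹ * ∑ i : Fin (N + 1), fracFn V (nearFieldKinetic (Φ N) τ s i z))
        ∂(localGibbsLaw σ a₀ u₀ θ₀ N (Φ N))
      ≤ ∫⁻ z, ENNReal.ofReal V⁻¹ * ENNReal.ofReal (((N : ℝ) + 1)⁻¹ *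
          ∑ i : Fin (N + 1), tailFn V (nearFieldKinetic (Φ N) τ s i z)) ∂(localGibbsLaw σ a₀ u₀ θ₀ N (Φ N)) := by
        refine lintegral_mono fun z => ?_
        rw [← ENNReal.ofReal_mul (inv_nonneg.2 hVpos.le)]
        refine ENNReal.ofReal_le_ofReal ?_
        calc ((N : ℝ) + 1)⁻¹ * ∑ i : Fin (N + 1), fracFn V (nearFieldKinetic (Φ N) τ s i z)
            ≤ ((N : ℝ) + 1)⁻¹ * ∑ i : Fin (N + 1), V⁻¹ * tailFn V (nearFieldKinetic (Φ N) τ s i z) :=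
              mul_le_mul_of_nonneg_left (Finset.sum_le_sum fun i _ => fracFn_le_inv_mul_tailFn hVpos _) hN0
          _ = V⁻¹ * (((N : ℝ) + 1)⁻¹ * ∑ i : Fin (N + 1), tailFn V (nearFieldKinetic (Φ N) τ s i z)) := by
              rw [← Finset.mul_sum]
              ring
    _ = ENNReal.ofReal V⁻¹ * ∫⁻ z, ENNReal.ofReal (((N : ℝ) + 1)⁻¹ *
          ∑ i : Fin (N + 1), tailFn V (nearFieldKinetic (Φ N) τ s i z)) ∂(localGibbsLaw σ a₀ u₀ θ₀ N (Φ N)) :=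
        lintegral_const_mul' _ _ ENNReal.ofReal_ne_top
    _ ≤ ENNReal.ofReal V⁻¹ * ENNReal.ofReal (δ * V) := mul_le_mul' le_rfl hint
    _ = ENNReal.ofReal δ := by
        rw [← ENNReal.ofReal_mul (inv_nonneg.2 hVpos.le)]
        congr 1
        field_simp

/-- On `{|v| > max M 1}` the square is below the cube (as in `JParityClosureKineticEnergyTails`). -/
theorem indicator_sq_le_indicator_cube' (M : ℝ) (v : V3) :
    Set.indicator {w : V3 | max M 1 < ‖w‖} (fun w => ‖w‖ ^ 2) v ≤
      Set.indicator {w : V3 | M < ‖w‖} (fun w => ‖w‖ ^ 3) v := by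
  by_cases hv : max M 1 < ‖v‖
  · have hM : M < ‖v‖ := lt_of_le_of_lt (le_max_left _ _) hv
    have h1 : 1 < ‖v‖ := lt_of_le_of_lt (le_max_right _ _) hv
    rw [Set.indicator_of_mem (show v ∈ {w : V3 | max M 1 < ‖w‖} from hv),
      Set.indicator_of_mem (show v ∈ {w : V3 | M < ‖w‖} from hM)]
    calc ‖v‖ ^ 2 = ‖v‖ ^ 2 * 1 := (mul_one _).symm
      _ ≤ ‖v‖ ^ 2 * ‖v‖ := mul_le_mul_of_nonneg_left h1.le (sq_nonneg _)
      _ = ‖v‖ ^ 3 := by ring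
  · rw [Set.indicator_of_notMem (show v ∉ {w : V3 | max M 1 < ‖w‖} from hv)]
    exact Set.indicator_nonneg (fun w _ => pow_nonneg (norm_nonneg w) 3) v

/-- **ROUTE-INTERNAL FORM OF THE REDUCTION.** With the route's binder `EnergyCurrentTails` (stmt-9235, a
hypothesis of `closes` in both TwoClocks and OneFlightGossipEngine; stated here for the `OneFlightGossipEngine`
copy of the decl), stub 5 follows from the in-probability tagged-sphere window LLN alone. The cubic item gives the
quadratic UI with cut-off `max M 1` (same twelve lines as the tree's `kineticEnergyTails_of_energyCurrentTails`,
inlined so that this file does not pose as a proof of item 13087). -/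
theorem nearFieldKineticTails_of_energyCurrentTails_of_fractionLLN
    (h₆ : Summit.AtomisticToContinuum.HydrodynamicLimit.Theses.OneFlightGossipEngine.EnergyCurrentTails)
    (hFR : NearFieldFractionLLN) : NearFieldKineticTails := by
  refine nearFieldKineticTails_of_kineticEnergyTails_of_fractionLLN ?_ hFR
  intro a₀ θ₀ u₀ ha hθ hu ha0 hθ0
  obtain ⟨σ₀, hσ₀, hσ⟩ := h₆ a₀ θ₀ u₀ ha hθ hu ha0 hθ0
  refine ⟨σ₀, hσ₀, fun σ hσp hσl T ρ θ u hE Φ hLLN t ht ε hε => ?_⟩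
  obtain ⟨M, N₀, hM⟩ := hσ σ hσp hσl T ρ θ u hE Φ hLLN t ht ε hε
  refine ⟨max M 1, N₀, fun N hN s hs => le_trans (lintegral_mono fun z => ?_) (hM N hN s hs)⟩
  refine ENNReal.ofReal_le_ofReal ?_
  exact mul_le_mul_of_nonneg_left
    (Finset.sum_le_sum fun i _ => indicator_sq_le_indicator_cube' M _) (by positivity)

/-! ## §5 The registered stub -/

/-- **STUB 5d (`stub_nearFieldReduction`, line `SketchK1`).** Uniform integrability of the kinetic energy along
the true flow before the shock (`JParityClosure.KineticEnergyTails`, item stmt-AtomisticToContinuum-13087) and the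
in-probability tagged-sphere window LLN `NearFieldFractionLLN` imply the line's near-field kinetic tail statement
`NearFieldKineticTails` (`nearFieldKineticTails_of_kineticEnergyTails_of_fractionLLN`). -/
theorem stub_nearFieldReduction : KineticEnergyTails → NearFieldFractionLLN → NearFieldKineticTails :=
  nearFieldKineticTails_of_kineticEnergyTails_of_fractionLLN

end Summit.AtomisticToContinuum.HydrodynamicLimit.Theorems.CollisionActivityTailsNearFieldKineticTails

end
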